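import Mathlib
import Summits.Ventures.PercRepro2.SwSide
import Summits.Ventures.PercRepro2.SwGlueO

/-!
# The blue-side permutation of `h` (blind cell PercRepro2, night-4 g4, 2026-08-24; NIGHT4-SIDE.md §5 —
the map `θ₂` of the cut-vertex composition P1)

On `{c ∈ B_h} = {c ∈ C_B(h), c ∉ C_R(h)}` the law of `C_B(h)` dominates the law of `C_R(h)`: for every
up-set `𝓥`, `#{c ∈ B_h, C_R(h) ∈ 𝓥} ≤ #{c ∈ B_h, C_B(h) ∈ 𝓥}` (`card_bside_le`, Harris on the full cube
after the colour swap of the left side), hence (Hall) a permutation `θ` of `{c ∈ B_h}` with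
`C_R(h)(y) ⊆ C_B(h)(θ y)` (`exists_bsidePerm`).
-/

namespace Summit.Ventures.PercRepro2

namespace Glue

open Hull SwSide

open scoped Classical

variable {V : Type*} {E : Type*} [Fintype E] [DecidableEq E] (ends : E → Sym2 V)

omit [Fintype E] [DecidableEq E] in
/-- `{c ∈ C_R(h), c ∉ C_B(h)}` is increasing. -/
lemma isUpperSet_rsideOf (c h : V) :
    IsUpperSet {ζ : Config E | c ∈ cluster ends ζ h ∧ c ∉ cluster ends (blue ζ) h} := by
  intro ζ ζ' hle ⟨h1, h2⟩
  exact ⟨cluster_mono hle h h1, fun h3 => h2 (cluster_mono (blue_le_blue_of_le hle) h h3)⟩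

omit [Fintype E] [DecidableEq E] in
/-- `{c ∈ C_B(h), c ∉ C_R(h)}` is decreasing. -/
lemma isLowerSet_bsideOf (c h : V) :
    IsLowerSet {ζ : Config E | c ∈ cluster ends (blue ζ) h ∧ c ∉ cluster ends ζ h} := by
  intro ζ ζ' hle ⟨h1, h2⟩
  exact ⟨cluster_mono (blue_le_blue_of_le hle) h h1, fun h3 => h2 (cluster_mono hle h h3)⟩

/-- The colour swap: `#{c ∈ B_h, C_R(h) ∈ 𝓥} ≤ #{c ∈ R_h, C_B(h) ∈ 𝓥}`. -/
lemma card_bside_swap_le (c h : V) (𝓥 : Set (Set V)) :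
    (Finset.univ.filter fun ζ : Config E =>
        (c ∈ cluster ends (blue ζ) h ∧ c ∉ cluster ends ζ h) ∧ cluster ends ζ h ∈ 𝓥).card ≤
      (Finset.univ.filter fun ζ : Config E =>
        (c ∈ cluster ends ζ h ∧ c ∉ cluster ends (blue ζ) h) ∧ cluster ends (blue ζ) h ∈ 𝓥).card := by
  refine Finset.card_le_card_of_injOn blue ?_ ?_
  · intro ζ hζ
    rw [Finset.mem_coe, Finset.mem_filter] at hζ
    rw [Finset.mem_coe, Finset.mem_filter, blue_blue]
    exact ⟨Finset.mem_univ _, hζ.2⟩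
  · intro ζ₁ _ ζ₂ _ h12
    have := congrArg blue h12
    simpa only [blue_blue] using this

/-- The colour swap: `#{c ∈ R_h} = #{c ∈ B_h}`. -/
lemma card_rsideOf_eq (c h : V) :
    (Finset.univ.filter fun ζ : Config E => c ∈ cluster ends ζ h ∧ c ∉ cluster ends (blue ζ) h).card =
      (Finset.univ.filter fun ζ : Config E =>
        c ∈ cluster ends (blue ζ) h ∧ c ∉ cluster ends ζ h).card := by
  refine Finset.card_bij (fun ζ _ => blue ζ) ?_ ?_ ?_
  · intro ζ hζ
    rw [Finset.mem_filter] at hζ ⊢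
    rw [blue_blue]
    exact ⟨Finset.mem_univ _, hζ.2⟩
  · intro ζ₁ _ ζ₂ _ h12
    have := congrArg blue h12
    simpa only [blue_blue] using this
  · intro ζ hζ
    rw [Finset.mem_filter] at hζ
    refine ⟨blue ζ, ?_, blue_blue ζ⟩
    rw [Finset.mem_filter, blue_blue]
    exact ⟨Finset.mem_univ _, hζ.2⟩

/-- **The blue-side domination** (Harris): for every up-set `𝓥`,
`#{c ∈ B_h, C_R(h) ∈ 𝓥} ≤ #{c ∈ B_h, C_B(h) ∈ 𝓥}`. -/
theorem card_bside_le (c h : V) {𝓥 : Set (Set V)} (h𝓥 : IsUpperSet 𝓥) :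
    (Finset.univ.filter fun ζ : Config E =>
        (c ∈ cluster ends (blue ζ) h ∧ c ∉ cluster ends ζ h) ∧ cluster ends ζ h ∈ 𝓥).card ≤
      (Finset.univ.filter fun ζ : Config E =>
        (c ∈ cluster ends (blue ζ) h ∧ c ∉ cluster ends ζ h) ∧ cluster ends (blue ζ) h ∈ 𝓥).card := by
  set ζ₀ : Config E := fun _ => false
  have hN : 0 < 2 ^ (∅ : Finset E)ᶜ.card := by positivity
  have h1 := cnt_le_cnt_mul_cnt_of_lower ζ₀ ∅ (X := {ζ : Config E | cluster ends (blue ζ) h ∈ 𝓥})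
    (Y := {ζ : Config E | c ∈ cluster ends ζ h ∧ c ∉ cluster ends (blue ζ) h})
    (isLowerSet_blueCluster_mem ends h h𝓥) (isUpperSet_rsideOf ends c h)
  have h2 := cnt_mul_cnt_le_of_lower ζ₀ ∅
    (X := {ζ : Config E | c ∈ cluster ends (blue ζ) h ∧ c ∉ cluster ends ζ h})
    (Y := {ζ : Config E | cluster ends (blue ζ) h ∈ 𝓥}) (isLowerSet_bsideOf ends c h)
    (isLowerSet_blueCluster_mem ends h h𝓥)
  rw [cnt_empty_inter, cnt_empty_pred, cnt_empty_pred] at h1 h2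
  have hswap := card_bside_swap_le ends c h 𝓥
  have e1 : (Finset.univ.filter fun ζ : Config E =>
      (c ∈ cluster ends ζ h ∧ c ∉ cluster ends (blue ζ) h) ∧ cluster ends (blue ζ) h ∈ 𝓥).card =
      (Finset.univ.filter fun ζ : Config E =>
      cluster ends (blue ζ) h ∈ 𝓥 ∧ (c ∈ cluster ends ζ h ∧ c ∉ cluster ends (blue ζ) h)).card := by
    congr 1; ext ζ; simp only [Finset.mem_filter]; tauto
  refine Nat.le_of_mul_le_mul_right ?_ hN
  calc (Finset.univ.filter fun ζ : Config E =>
        (c ∈ cluster ends (blue ζ) h ∧ c ∉ cluster ends ζ h) ∧ cluster ends ζ h ∈ 𝓥).card *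
        2 ^ (∅ : Finset E)ᶜ.card
      ≤ (Finset.univ.filter fun ζ : Config E =>
          cluster ends (blue ζ) h ∈ 𝓥 ∧ (c ∈ cluster ends ζ h ∧ c ∉ cluster ends (blue ζ) h)).card *
          2 ^ (∅ : Finset E)ᶜ.card := by
        rw [← e1]; exact Nat.mul_le_mul_right _ hswap
    _ ≤ (Finset.univ.filter fun ζ : Config E => cluster ends (blue ζ) h ∈ 𝓥).card *
          (Finset.univ.filter fun ζ : Config E =>
            c ∈ cluster ends ζ h ∧ c ∉ cluster ends (blue ζ) h).card := h1
    _ = (Finset.univ.filter fun ζ : Config E => cluster ends (blue ζ) h ∈ 𝓥).card *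
          (Finset.univ.filter fun ζ : Config E =>
            c ∈ cluster ends (blue ζ) h ∧ c ∉ cluster ends ζ h).card := by
        rw [card_rsideOf_eq ends c h]
    _ = (Finset.univ.filter fun ζ : Config E =>
            c ∈ cluster ends (blue ζ) h ∧ c ∉ cluster ends ζ h).card *
          (Finset.univ.filter fun ζ : Config E => cluster ends (blue ζ) h ∈ 𝓥).card := by ring
    _ ≤ (Finset.univ.filter fun ζ : Config E =>
          (c ∈ cluster ends (blue ζ) h ∧ c ∉ cluster ends ζ h) ∧ cluster ends (blue ζ) h ∈ 𝓥).card *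
          2 ^ (∅ : Finset E)ᶜ.card := h2

/-- `{c ∈ B_h}` as a Finset. -/
noncomputable def bsideSet (c h : V) : Finset (Config E) :=
  Finset.univ.filter fun ζ => c ∈ cluster ends (blue ζ) h ∧ c ∉ cluster ends ζ h

/-- **The blue-side permutation** (Hall): an injection of `{c ∈ B_h}` into itself carrying `C_R(h)`
into `C_B(h)` of the image. -/
theorem exists_bsidePerm (c h : V) :
    ∃ θ : {ζ // ζ ∈ bsideSet ends c h} → Config E, Function.Injective θ ∧
      ∀ y, θ y ∈ bsideSet ends c h ∧ cluster ends y.1 h ⊆ cluster ends (blue (θ y)) h := by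
  let t : {ζ // ζ ∈ bsideSet ends c h} → Finset (Config E) := fun y =>
    (bsideSet ends c h).filter fun ζ' => cluster ends y.1 h ⊆ cluster ends (blue ζ') h
  have hall : ∀ s : Finset {ζ // ζ ∈ bsideSet ends c h}, s.card ≤ (s.biUnion t).card := by
    intro s
    let 𝓥 : Set (Set V) := {S | ∃ y ∈ s, cluster ends y.1 h ⊆ S}
    have h𝓥 : IsUpperSet 𝓥 := by
      intro S S' hSS' ⟨y, hy, hyS⟩
      exact ⟨y, hy, hyS.trans hSS'⟩
    have e1 : s.biUnion t = Finset.univ.filter fun ζ : Config E =>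
        (c ∈ cluster ends (blue ζ) h ∧ c ∉ cluster ends ζ h) ∧ cluster ends (blue ζ) h ∈ 𝓥 := by
      ext ζ'
      simp only [Finset.mem_biUnion, Finset.mem_filter, t, 𝓥, Set.mem_setOf_eq, bsideSet,
        Finset.mem_univ, true_and]
      constructor
      · rintro ⟨y, hy, h1, hsub⟩
        exact ⟨h1, y, hy, hsub⟩
      · rintro ⟨h1, y, hy, hsub⟩
        exact ⟨y, hy, h1, hsub⟩
    have e2 : s.card ≤ (Finset.univ.filter fun ζ : Config E =>
        (c ∈ cluster ends (blue ζ) h ∧ c ∉ cluster ends ζ h) ∧ cluster ends ζ h ∈ 𝓥).card := by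
      refine Finset.card_le_card_of_injOn (fun y => y.1) ?_ ?_
      · intro y hy
        rw [Finset.mem_coe] at hy
        have hy1 := y.2
        simp only [bsideSet, Finset.mem_filter, Finset.mem_univ, true_and] at hy1
        simp only [Finset.mem_coe, Finset.mem_filter, Finset.mem_univ, true_and]
        exact ⟨hy1, y, hy, subset_rfl⟩
      · intro x _ y _ hxy
        exact Subtype.ext hxy
    rw [e1]
    refine Nat.le_trans e2 ?_
    convert card_bside_le ends c h h𝓥 using 4
  obtain ⟨f, hf, hft⟩ := (Finset.all_card_le_biUnion_card_iff_exists_injective t).1 hall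
  refine ⟨f, hf, fun y => ?_⟩
  have := hft y
  simp only [t, Finset.mem_filter] at this
  exact this

end Glue

end Summit.Ventures.PercRepro2
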